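import Summits.Ventures.AbcSig.Recipes.FreyTracePackage
import Summits.Ventures.AbcSig.Conjectures.KrausTableRefines

/-!
# Venture AbcSig — [BS04, Lemma 4.2] as a THEOREM for the Frey curve of a datum; the Kraus-table and coarse trace hypotheses DERIVED

HONEST FRAMING. Elementary-arithmetic + glue file of the COMPUTATION cell `pub-abcsig`; no Diophantine equation is solved, no new
hypothesis is introduced, nothing is a claim on ABC or any summit. It completes `Recipes/FreyTracePackage.lean`: there the trace package
(CITED) was shown to put `ψ(c_q)` into the Kraus table at every odd prime; here the COARSE list [BS04, Lemma 4.2] is obtained at the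
remaining primes from Hasse's theorem (the tree's sorry-free elementary proof, `Literature.NumberTheory.EllipticCurves.HasseElementary`,
through the cell's `Conjectures/KrausTableSemantics.lean` / `KrausTableRefines.lean`) and the rational `2`-torsion point.

WHAT IS PROVED.
* `isElliptic_enumCurve_datum` — good reduction: for `A aⁿ + B bⁿ = C c²` and an odd prime `q ∤ ABC·ab` the reduced Frey curve
  (the generator's curve at the datum's residues, whose trace is `freyTrace μ S q`) is elliptic over `ZMod q` ([BS04, Lemma 2.1(a)]:
  `Δ = 2^{δ} C³ B² A (ab²)ⁿ`).
* `traceNaive_three_mem_bs04Allowed`, `traceNaive_mem_bs04Allowed_three` — the prime `q = 3` (outside `char ≠ 2, 3` of the tree's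
  Hasse theorem) by a finite check of the nine curves over `𝔽₃`.
* **`freyTrace_mem_bs04Allowed`** — [BS04, Lemma 4.2], good-reduction case: `freyTrace μ S q ∈ bs04Allowed q` (even, square `≤ 4q`)
  for every odd prime `q ∤ ABC·ab`.
* **`FreyTracePackage.arisesMod_krausTableAt`** (+ `_level`) — under the trace package, for a standing datum in case `κ`, a level `N`
  divisible by the odd part `bs04OddLevel A B C n` of the Serre level (in particular the Serre level itself) and `M.Arises S N f`:
  `M.ArisesMod f n (krausTableAt κ.model A B C n aux)` for ANY list `aux` of auxiliary primes — the `RefinedTraces` hypothesis of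
  `Rows/TemplateKraus.lean` in standing form, DERIVED.
* **`FreyTracePackage.arisesMod_bs04Allowed`** (+ `_level`) — the special case `aux = []`: `M.ArisesMod f n bs04Allowed`, i.e. clause (2)
  of `NewformModel.BS04Package` ([BS04, (3.1) + Lemma 4.2]) is a CONSEQUENCE of the trace package at such levels.
Row templates are not touched here (their rewiring from `RefinedTraces`/clause (2) to `FreyTracePackage` is the Lean owner's call).

References: [BS04] Bennett–Skinner, Canad. J. Math. 56 (2004): Lemma 2.1, (3.1), Lemma 3.2, Lemma 4.2, Prop. 4.3; A. W. Knapp,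
*Elliptic Curves* (1992) §X.3 (Hasse, as formalised in the tree's `HasseElementary`); A. Kraus, Canad. J. Math. 49 (1997).
-/

namespace Summit.Ventures.AbcSig

/-! ## Good reduction: the reduced Frey curve is elliptic at odd `q ∤ ABC·ab` -/

/-- `bⁿ mod q` is a nonzero residue when the prime `q` does not divide `b`. -/
theorem natCast_toNat_pow_emod_ne_zero {q : ℕ} (hq : q.Prime) (n : ℕ) {z : ℤ} (hz : ¬ (q : ℤ) ∣ z) :
    ((Int.toNat ((z ^ n) % (q : ℤ)) : ℕ) : ZMod q) ≠ 0 := by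
  haveI : Fact q.Prime := ⟨hq⟩
  rw [natCast_toNat_emod _ hq.ne_zero, Int.cast_pow]
  exact pow_ne_zero _ fun h => hz ((ZMod.intCast_zmod_eq_zero_iff_dvd _ q).mp h)

/-- **Good reduction [BS04, Lemma 2.1(a)]: `Δ(E_i) = 2^{δ_i} C³ B² A (ab²)ⁿ`.** For `A aⁿ + B bⁿ = C c²` and an odd prime `q`
dividing none of `A, B, C, a, b`, the curve over `ZMod q` that the generator attaches to the datum's residues `(bⁿ mod q, c mod q)`
— whose trace is `freyTrace μ S q` — is elliptic. -/
theorem isElliptic_enumCurve_datum (μ : FreyModel) (S : FreyDatum) {q : ℕ} [Fact q.Prime] (hq2 : q ≠ 2)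
    (heq : (S.A : ℤ) * S.a ^ S.n + S.B * S.b ^ S.n = S.C * S.c ^ 2)
    (hA : ¬ (q : ℤ) ∣ S.A) (hB : ¬ q ∣ S.B) (hC : ¬ q ∣ S.C) (ha : ¬ (q : ℤ) ∣ S.a) (hb : ¬ (q : ℤ) ∣ S.b) :
    (Conjectures.enumCurve μ q S.B S.C (Int.toNat ((S.b ^ S.n) % (q : ℤ))) (Int.toNat (S.c % (q : ℤ)))).IsElliptic := by
  have hq : q.Prime := Fact.out
  have hB' : (S.B : ZMod q) ≠ 0 := fun h => hB ((ZMod.natCast_eq_zero_iff S.B q).mp h)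
  have hC' : (S.C : ZMod q) ≠ 0 := fun h => hC ((ZMod.natCast_eq_zero_iff S.C q).mp h)
  exact Conjectures.isElliptic_enumCurve μ hq2 hB' hC' (natCast_toNat_pow_emod_ne_zero hq S.n hb)
    (krausKept_ne_zero S hq heq hA ha)

/-! ## The prime `3` (outside the reach of the tree's Hasse theorem, which needs `char ≠ 2, 3`): a finite check -/

/-- Over `𝔽₃`, every NONSINGULAR `Y² = X³ + a₂X² + a₄X` (`a₄ ≠ 0`, `a₂² − 4a₄ ≠ 0`) has naive trace in `bs04Allowed 3 = {0, ±2, ±4}`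
(all `9` coefficient pairs checked by `decide`; the singular pairs `(1, 0)`, `(2, 0)` would give the odd traces `1`, `−1`). -/
theorem traceNaive_three_mem_bs04Allowed : ∀ a₂ a₄ : Fin 3, (a₄ : ℕ) ≠ 0 →
    ((a₂ : ℕ) * a₂ + 2 * a₄) % 3 ≠ 0 → traceNaive 3 a₂ a₄ ∈ bs04Allowed 3 := by
  decide

/-- The `q = 3` case of "`traceNaive` of an elliptic `⟨0, a₂, 0, a₄, 0⟩` lies in `bs04Allowed`", with the coefficient residues
`a₂, a₄ < 3`. -/
theorem traceNaive_mem_bs04Allowed_three (a₂ a₄ : ℕ) (ha₂ : a₂ < 3) (ha₄ : a₄ < 3)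
    (E : WeierstrassCurve (ZMod 3)) [E.IsElliptic] (h₁ : E.a₁ = 0) (h₂ : E.a₂ = a₂) (h₃ : E.a₃ = 0) (h₄ : E.a₄ = a₄)
    (h₆ : E.a₆ = 0) : traceNaive 3 a₂ a₄ ∈ bs04Allowed 3 := by
  have hΔ : E.Δ ≠ 0 := by
    have h := ‹E.IsElliptic›
    rw [WeierstrassCurve.isElliptic_iff] at h
    exact h.ne_zero
  rw [Conjectures.Δ_of_a₁_a₃_a₆_zero E h₁ h₃ h₆, h₂, h₄] at hΔ
  have ha₄0 : (a₄ : ZMod 3) ≠ 0 := fun h => hΔ (by rw [h]; ring)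
  have hdisc : ((a₂ : ZMod 3)) ^ 2 - 4 * (a₄ : ZMod 3) ≠ 0 := fun h => hΔ (by rw [h]; ring)
  refine traceNaive_three_mem_bs04Allowed ⟨a₂, ha₂⟩ ⟨a₄, ha₄⟩ ?_ ?_
  · intro h0
    change a₄ = 0 at h0
    subst h0
    exact ha₄0 (by simp)
  · intro h0
    change (a₂ * a₂ + 2 * a₄) % 3 = 0 at h0
    apply hdisc
    have hdvd : 3 ∣ a₂ * a₂ + 2 * a₄ := Nat.dvd_of_mod_eq_zero h0
    have hcast : ((a₂ * a₂ + 2 * a₄ : ℕ) : ZMod 3) = 0 := (ZMod.natCast_eq_zero_iff _ 3).mpr hdvd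
    push_cast at hcast
    have h6 : (6 : ZMod 3) = 0 := by decide
    linear_combination hcast - (a₄ : ZMod 3) * h6

/-! ## [BS04, Lemma 4.2] as a theorem: the Frey trace at a good odd prime is even with square at most `4q` -/

/-- **[BS04, Lemma 4.2], good-reduction case, PROVED.** "Suppose `n ≥ 7` is a prime and `E = E_i(a,b,c)` is a curve associated to a
primitive solution of (1.2). Suppose also that `p` is an odd prime not dividing `n N_n^E`. Then either `trace ρ^E_n(Frob_p) = ±(1 + p)`
or `trace ρ^E_n(Frob_p) = ±2r`, for some integer `r ≤ √p`" (p. 33) — the second alternative being `a_p(E)` at a prime of good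
reduction: `a_p` is even because `E` has the rational `2`-torsion point `(0, 0)` [Lemma 2.1(c)], and `a_p² ≤ 4p` by Hasse. Here: for
`A aⁿ + B bⁿ = C c²` and an odd prime `q ∤ ABC·ab`, `freyTrace μ S q ∈ bs04Allowed q`. Hasse's bound is the tree's sorry-free
elementary proof (`Literature.NumberTheory.EllipticCurves.HasseElementary`, Manin/Knapp; `char ≠ 2, 3`) via the cell's
`Conjectures.traceNaive_mem_bs04Allowed`; `q = 3` is the finite check `traceNaive_mem_bs04Allowed_three`. -/
theorem freyTrace_mem_bs04Allowed (μ : FreyModel) (S : FreyDatum) {q : ℕ} (hq : q.Prime) (hq2 : q ≠ 2)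
    (heq : (S.A : ℤ) * S.a ^ S.n + S.B * S.b ^ S.n = S.C * S.c ^ 2)
    (hA : ¬ (q : ℤ) ∣ S.A) (hB : ¬ q ∣ S.B) (hC : ¬ q ∣ S.C) (ha : ¬ (q : ℤ) ∣ S.a) (hb : ¬ (q : ℤ) ∣ S.b) :
    freyTrace μ S q ∈ bs04Allowed q := by
  haveI : Fact q.Prime := ⟨hq⟩
  haveI := isElliptic_enumCurve_datum μ S hq2 heq hA hB hC ha hb
  set u : ℕ := Int.toNat ((S.b ^ S.n) % (q : ℤ)) with hu
  set c₀ : ℕ := Int.toNat (S.c % (q : ℤ)) with hc₀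
  show traceNaive q (μ.coeffs q S.B S.C u c₀).1 (μ.coeffs q S.B S.C u c₀).2 ∈ bs04Allowed q
  by_cases hq3 : q = 3
  · subst hq3
    have hlt : ∀ ν : FreyModel, (ν.coeffs 3 S.B S.C u c₀).1 < 3 ∧ (ν.coeffs 3 S.B S.C u c₀).2 < 3 := by
      intro ν
      cases ν <;> exact ⟨Nat.mod_lt _ (by norm_num), Nat.mod_lt _ (by norm_num)⟩
    exact traceNaive_mem_bs04Allowed_three _ _ (hlt μ).1 (hlt μ).2 (Conjectures.enumCurve μ 3 S.B S.C u c₀)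
      rfl rfl rfl rfl rfl
  · exact Conjectures.traceNaive_mem_bs04Allowed hq2 hq3 _ _ (Conjectures.enumCurve μ q S.B S.C u c₀) rfl rfl rfl rfl rfl

/-- `±(q + 1)` lie in `bs04Allowed q`. -/
theorem neg_succ_mem_bs04Allowed (q : ℕ) : -((q : ℤ) + 1) ∈ bs04Allowed q :=
  (mem_bs04Allowed_iff q _).mpr (Or.inr (by omega))

/-- `±(q + 1)` lie in `bs04Allowed q`. -/
theorem succ_mem_bs04Allowed (q : ℕ) : (q : ℤ) + 1 ∈ bs04Allowed q :=
  (mem_bs04Allowed_iff q _).mpr (Or.inr (by omega))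

/-! ## Consequences for the abstract model: Kraus tables and [BS04, Lemma 4.2] from the trace package -/

/-- The auxiliary-prime list is irrelevant away from it: with no auxiliary primes the table is the coarse one. -/
theorem krausTableAt_nil (μ : FreyModel) (A B C n : ℕ) : krausTableAt μ A B C n [] = bs04Allowed := by
  funext q
  simp [krausTableAt]

/-- **The Kraus-table hypothesis of the cell's rows, DERIVED (standing form).** Under `FreyTracePackage`: for a standing datum `S` in
case `κ`, a level `N` divisible by the odd part `bs04OddLevel A B C n` of the Serre level, a newform `f` with `M.Arises S N f`, and ANY
list of auxiliary primes, `M.ArisesMod f n (krausTableAt κ.model A B C n aux)` — at the auxiliary primes by the soundness of the generator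
(`freyTrace_mem_krausTable`), at the other odd primes by [BS04, Lemma 4.2] (`freyTrace_mem_bs04Allowed`), at primes `q ∣ ab` by the
entries `±(q + 1)`. This is the content of `NewformModel.RefinedTraces fam (krausTableAt …)` for standing data. -/
theorem NewformModel.FreyTracePackage.arisesMod_krausTableAt {M : NewformModel} (hT : M.FreyTracePackage)
    (S : FreyDatum) (κ : FreyCase) (hS : Standing S κ) (N : ℕ) (hdiv : bs04OddLevel S.A S.B S.C S.n ∣ N) (f : M.Form N)
    (hf : M.Arises S N f) (aux : List ℕ) : M.ArisesMod f S.n (krausTableAt κ.model S.A S.B S.C S.n aux) := by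
  obtain ⟨k, hk, hchar, ψ, hψ⟩ := hT.exists_psi_mem_krausTable S κ hS N hdiv f hf
  refine ⟨k, hk, hchar, ψ, fun q hq hq2 hqn hqN => ?_⟩
  obtain ⟨hkr, hmult, hgood⟩ := hψ q hq hq2 hqn hqN
  unfold krausTableAt
  split_ifs with hmem
  · exact hkr
  · by_cases hab : (q : ℤ) ∣ S.a * S.b
    · rcases hmult hab with h | h
      · exact ⟨_, succ_mem_bs04Allowed q, h⟩
      · exact ⟨_, neg_succ_mem_bs04Allowed q, h⟩
    · obtain ⟨hA0, hB0, hC0, -, -, -, -, -, hsol, -⟩ := hS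
      have hABC : ¬ q ∣ S.A * S.B * S.C := fun h => hqN ((dvd_bs04OddLevel_of_dvd hq hq2 hqn hA0 hB0 hC0 h).trans hdiv)
      have hA : ¬ (q : ℤ) ∣ S.A := by
        intro h
        have h' : q ∣ S.A := by exact_mod_cast h
        exact hABC ((h'.mul_right S.B).mul_right S.C)
      have hB : ¬ q ∣ S.B := fun h => hABC ((h.mul_left S.A).mul_right S.C)
      have hC : ¬ q ∣ S.C := fun h => hABC (h.mul_left (S.A * S.B))
      have ha : ¬ (q : ℤ) ∣ S.a := fun h => hab (h.mul_right _)
      have hb : ¬ (q : ℤ) ∣ S.b := fun h => hab (h.mul_left _)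
      exact ⟨_, freyTrace_mem_bs04Allowed κ.model S hq hq2 hsol.1 hA hB hC ha hb, hgood hab⟩

/-- **[BS04, Lemma 4.2 + (3.1)] from the trace package**: the trace congruences with the COARSE list — clause (2) of
`NewformModel.BS04Package` — at every level divisible by the odd part of the Serre level. -/
theorem NewformModel.FreyTracePackage.arisesMod_bs04Allowed {M : NewformModel} (hT : M.FreyTracePackage)
    (S : FreyDatum) (κ : FreyCase) (hS : Standing S κ) (N : ℕ) (hdiv : bs04OddLevel S.A S.B S.C S.n ∣ N) (f : M.Form N)
    (hf : M.Arises S N f) : M.ArisesMod f S.n bs04Allowed := by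
  have h := hT.arisesMod_krausTableAt S κ hS N hdiv f hf []
  rwa [krausTableAt_nil] at h

/-- The same at the Serre level `N = bs04Level κ A B C n` itself (`dvd_bs04Level_of_dvd`): the exact shape in which the cell's row
templates use clause (2) of `BS04Package`, now a CONSEQUENCE of `FreyTracePackage`. -/
theorem NewformModel.FreyTracePackage.arisesMod_bs04Allowed_level {M : NewformModel} (hT : M.FreyTracePackage)
    (S : FreyDatum) (κ : FreyCase) (hS : Standing S κ) (N : ℕ) (hlev : bs04Level κ S.A S.B S.C S.n = N) (f : M.Form N)
    (hf : M.Arises S N f) : M.ArisesMod f S.n bs04Allowed :=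
  hT.arisesMod_bs04Allowed S κ hS N (hlev ▸ bs04OddLevel_dvd_bs04Level κ S.A S.B S.C S.n) f hf

/-- … and the Kraus tables at the Serre level, for any auxiliary primes. -/
theorem NewformModel.FreyTracePackage.arisesMod_krausTableAt_level {M : NewformModel} (hT : M.FreyTracePackage)
    (S : FreyDatum) (κ : FreyCase) (hS : Standing S κ) (N : ℕ) (hlev : bs04Level κ S.A S.B S.C S.n = N) (f : M.Form N)
    (hf : M.Arises S N f) (aux : List ℕ) : M.ArisesMod f S.n (krausTableAt κ.model S.A S.B S.C S.n aux) :=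
  hT.arisesMod_krausTableAt S κ hS N (hlev ▸ bs04OddLevel_dvd_bs04Level κ S.A S.B S.C S.n) f hf aux

end Summit.Ventures.AbcSig
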